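import Literature.Probability.LatticeModels.DirichletGreenFunction
import Literature.Probability.LatticeModels.HoleFreePotential
import Mathlib.Combinatorics.SimpleGraph.Walk.Subwalks
import HarnessLib

/-!
# Kemppainen–Smirnov: the random-walk dead-end bound behind an annulus (Condition G2 for the walk
driving chordal LERW), site form on hole-free subsets of `ℤ²`

Topic `Literature/Probability/LatticeModels`; companion of `DirichletGreenFunction.lean` (`dirichletGreen`,
the Green function of the simple random walk killed on leaving a finite set), `HoleFreePotential.lean`
(`HoleFree`), `DomainDiscretisation.lean` (`meshPoint`) and `WeakBeurlingEstimate.lean`. ONE NAMED FACT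
(statement only, nothing asserted) from A. Kemppainen, S. Smirnov, *Random curves, scaling limits and
Loewner evolutions*, Ann. Probab. 45 (2017) 698–779, arXiv:1212.6215v3 (`KemppainenSmirnov2017`):
the random-walk content of their verification of Condition G2 for the loop-erased random walk — proof
of Theorem 4.12 (p. 27, with Proposition 4.11, p. 27, whose lattice inputs are the Beurling estimate
Lemma 4.9, Harnack's inequality and D. Chelkak, *Robust discrete complex analysis: a toolbox*, Ann.
Probab. 44 (2016), Prop. 3.3, `Chelkak2016`) combined with the quad-to-annulus summation in the proof of
Proposition 2.5 (pp. 10–11) and Definition 2.2 (p. 9, avoidable part `A^u` of an annulus): the walk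
from `a` conditioned to hit `b` visits a set reachable from `a` only through AVOIDABLE crossings of an
annulus `r ≤ |z - z₀| ≤ R` of modulus `R/r ≥ M`, whose inner circle meets the boundary, with
probability `≤ 1 - η`. The dictionary (site-killed walk on a finite hole-free set of sites, interior
target with the conditioning `{τ_b < ζ}`, crossings as sub-walks, avoidability through lattice
components of `Λ ∩ Ā`, the event through Green functions) and the list of what print does NOT cover
verbatim are in the docstring of the `Prop`.

Why here: the line `excursion-domination` of crux `FKGToTraversalBound` (stmt-CriticalPhenomena-1878,
`Summits/CriticalPhenomena/SAWScalingLimit`) reduces its stub `stub_killedWalkCollarBound` (the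
killed-walk collar bound on hole-free lattice domains) to exactly this statement
(`Theorems/SAWLeftRightFKGFKGToTraversalBoundKilledWalkCollarBound.lean`,
`stub_killedWalkCollarBound_of_deadEndBound`, whose hypothesis is this `Prop` unfolded); the topological
half of that reduction and the diagonal case are proved there from the tree. Statement transcribed from
the held text (`lit read arxiv:1212.6215`, pp. 9–11, 26–28) by the line lead's stub worker; NOT proved
here. The inputs of the printed proof that the tree lacks: Chelkak 2016, Prop. 3.3 (the bridge of the
walk across a quad hits a balanced inner ball with uniformly positive probability) and the discrete
extremal length of lattice quads; the tree has the weak Beurling estimate (`weakBeurling_of_cutPath`) and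
the one-scale Harnack inequality (`harnack_one_scale`).
-/

noncomputable section

namespace Literature.Probability.LatticeModels

/-- **Kemppainen–Smirnov 2017 — the random-walk dead-end bound behind an annulus (Condition G2 for the
walk driving chordal LERW), site form on hole-free subsets of `ℤ²`** (named fact, NOT proved in the
tree). A. Kemppainen, S. Smirnov, *Random curves, scaling limits and Loewner evolutions*, Ann. Probab.
45 (2017) 698–779, arXiv:1212.6215v3.
WHAT PRINT PROVES. §4.4 (pp. 26–28): `U` a bounded simply connected domain whose boundary is a path in
`ℤ²`; `X` the simple random walk on `Ū ∩ ℤ²` from a vertex `a`, stopped at the hitting time `T` of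
`∂U`; `P_{a→b}` its law conditioned on `X_T = b`. Theorem 4.12 ("Condition C2 holds for LERW") is proved
through the RANDOM-WALK statement (proof, p. 27, from Prop. 4.11, p. 27, whose inputs are the Beurling
estimate Lemma 4.9, Harnack's inequality, and D. Chelkak, *Robust discrete complex analysis: a toolbox*,
Ann. Probab. 44 (2016), Prop. 3.3 [`Chelkak2016`; the bridge of the walk across a quad hits a balanced
inner ball with probability `≥ ε₀`]): for an avoidable topological quadrilateral `Q ⊂ U` with two
opposite sides on `∂U`, far side `S₂` disconnected from `b` by the near side `S₀`, and modulus
`m(Q) ≥ n L₀`: `P_{a→b}(X hits S₂ before T) ≤ 1/2` ("there is uniformly positive probability that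
`(X_t)` conditioned on `X_T = b` doesn't cross `Q`. By iterating that estimate … the probability of
crossing is at most `1/2`"). Proposition 2.5, proof of (C2-exp ⇒ G2) (pp. 10–11: a separating family of
arcs `I_j` of the circles `∂B(z₀, r eˣ)` with `∑_j exp(-ε ℓ(I_j)) < 1/(2K)`), converts quad bounds into
the ANNULUS form, Condition G2 (Def. 2.2, p. 9): for `R ≥ C r` and `∂B(z₀, r) ∩ ∂U ≠ ∅`, a crossing of
`A(z₀, r, R)` contained in the AVOIDABLE part `A^u = {z ∈ U ∩ A : the component of z in U ∩ A does not
disconnect the tip from b}` has probability `< 1/2`; for `X` under `P_{a→b}` (Markov property in place of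
the domain Markov property) the two proofs give: `X` visits, before `T`, a set `D` every path to which
from `a` contains a crossing of `A` inside `A^u`, with `P_{a→b}`-probability `≤ 1/2`.
STATED HERE (dictionary; mesh `δ`; tree vocabulary). DOMAIN: a finite HOLE-FREE set `Λ` of sites
(`HoleFree`: every site off `Λ` is joined off `Λ` to sites of arbitrarily large ordinate — the tree's
reading of "simply connected lattice domain"; KS's `U ∩ ℤ²` is such a set and their stopped walk is the
walk killed on leaving it), the walk KILLED on leaving `Λ`. TARGET AND CONDITIONING: a site `b` and the
event `{τ_b < ζ}` (hit `b` before being killed); in print `b` is a vertex of `∂U` and the event is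
`{X_T = b}` (§4.4, p. 26, notes that the radial/interior variants "can be verified in the same way").
WALL: `∂B(z₀,r) ∩ ∂U ≠ ∅` as "a site off `Λ` within `r + δ` of `z₀`". CROSSING CONTAINED IN `A^u`: a
sub-walk (`SimpleGraph.Walk.IsSubwalk`) from within `δ` of one circle of `r ≤ |δx - z₀| ≤ R` to within
`δ` of the other, all of whose sites `x` lie in `Λ ∩ Ā` and are AVOIDABLE: some lattice walk from `a` to
`b` in `Λ` meets no site joined to `x` inside `Λ ∩ Ā`. THE EVENT through Green functions
(`G = dirichletGreen`, Lawler 1991 §1.5; first-entrance decomposition `dirichletGreen_eq_sdiff_add_sum`):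
`P_a(τ_b < ζ) = G_Λ(a,b)/G_Λ(b,b)` and `P_a(τ_b < ζ ∧ τ_b < τ_D) = G_{Λ∖D}(a,b)/G_{Λ∖D}(b,b)` (`b ∉ D`),
so "`P_a(τ_D < τ_b | τ_b < ζ) ≤ 1 - η`" reads `η G_Λ(a,b) G_{Λ∖D}(b,b) ≤ G_{Λ∖D}(a,b) G_Λ(b,b)`.
CONSTANTS: `∃ M > 1, η > 0` (print: `C`, `1/2`; any constant in `(0,1)` by Cor. 2.6). Conclusion: that
inequality whenever every `Λ`-walk from `a` to a site of `D` contains an avoidable crossing.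
NOT covered verbatim by print (recorded for the consumers and the literature provers): (1) arbitrary
finite hole-free site sets in place of KS's lattice-path-bounded domains `U` (Chelkak's "simply
connected discrete domains", the setting of the Prop. 3.3 they invoke); (2) an interior target `b` with
`{τ_b < ζ}` in place of a boundary vertex with `{X_T = b}`; (3) the random-walk (hitting) reading of
Condition G2, which is what the proof of Thm. 4.12 (p. 27) and the summation of Prop. 2.5 (pp. 10–11)
establish before loop erasure; (4) avoidable components taken in the induced nearest-neighbour graph on
the sites of `Λ` in the CLOSED annulus, and circles thickened by `δ` (print: components of `U_τ ∩ A` for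
the open annulus) — a `δ`-scale change of convention at the two circles. The lattice inputs of those
proofs — Chelkak 2016 Prop. 3.3 and the discrete extremal length of the channels of `Λ ∩ Ā` — are not
in the tree; the weak Beurling estimate
(`weakBeurling_of_cutPath`) and the one-scale Harnack inequality (`harnack_one_scale`) they also use are.
[cite: KemppainenSmirnov2017, Thm. 4.12 (proof, p. 27) with Prop. 4.11 (p. 27), Prop. 2.5 (proof of C-exp ⇒ G2, pp. 10–11), Def. 2.2 (p. 9)] [topic Probability/LatticeModels] -/
@[cite "KemppainenSmirnov2017" "Thm. 4.12 (proof, p. 27), Prop. 4.11, Prop. 2.5 (pp. 10-11), Def. 2.2"]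
def KemppainenSmirnov2017_rwDeadEndBound : Prop :=
  ∃ (M η : ℝ), 1 < M ∧ 0 < η ∧ ∀ (δ : ℝ) (Λ : Finset (Site 2)) (a b : Site 2), 0 < δ →
    HoleFree (↑Λ : Set (Site 2)) →
    ∀ (z₀ : ℂ) (r R : ℝ) (D : Finset (Site 2)), δ ≤ r → M * r ≤ R →
      (∃ p : Site 2, p ∉ Λ ∧ dist (meshPoint δ p) z₀ ≤ r + δ) →
      (∀ e ∈ D, ∀ q : (zdGraph 2).Walk a e, (∀ x ∈ q.support, x ∈ Λ) →
        ∃ (u v : Site 2) (c : (zdGraph 2).Walk u v), c.IsSubwalk q ∧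
          ((dist (meshPoint δ u) z₀ < r + δ ∧ R - δ < dist (meshPoint δ v) z₀) ∨
           (R - δ < dist (meshPoint δ u) z₀ ∧ dist (meshPoint δ v) z₀ < r + δ)) ∧
          ∀ x ∈ c.support, x ∈ Λ ∧ r ≤ dist (meshPoint δ x) z₀ ∧ dist (meshPoint δ x) z₀ ≤ R ∧
            ∃ p : (zdGraph 2).Walk a b, ∀ y ∈ p.support, y ∈ Λ ∧
              ¬ ∃ t : (zdGraph 2).Walk x y, ∀ s ∈ t.support,
                  s ∈ Λ ∧ r ≤ dist (meshPoint δ s) z₀ ∧ dist (meshPoint δ s) z₀ ≤ R) →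
      η * (dirichletGreen Λ a b * dirichletGreen (Λ \ D) b b) ≤
        dirichletGreen (Λ \ D) a b * dirichletGreen Λ b b

end Literature.Probability.LatticeModels

end
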